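import Summits.QuantumAdvantage.QuantumAdvantage.Theorems.SparsityDialMP11

/-!
# SparsityDial — part MP12 of 12 of the «MovingPointers» package (decomp-qadv lens 2, g18): §H FIXED DEVIATION PATTERNS up to `√n/4` — `fixedPattern_loss` / `FixedPatternLoss3` (PROVED)

Imports its predecessor `SparsityDialMP11` (linear chain MP1 → … → MP12); the package overview is the module docstring of `SparsityDialMP1`.
This part: the `t = 0` (no hash) instance of the affine-table theorem `table_loss` of part MP10 — a strategy whose deviation set on
the odd class is ONE FIXED pattern `T` of ANY size with `16·(|T|+6)² ≤ n` (far beyond polylog: the dense blind regime included; after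
an arbitrary gauge, by `StabilizerDial.winset_pad`) loses at least a quarter of the odd class; packaged `FixedPatternLoss3` (PROVED).
No `sorry`; standard axioms; no instances / notation.
-/

set_option linter.unusedVariables false
set_option linter.dupNamespace false

noncomputable section
open scoped Classical

namespace Summit.QuantumAdvantage.QuantumAdvantage.Theorems.SparsityDial

open Finset
open Literature.Computability.QuantumComplexity Literature.Computability.QuantumComplexity.RingHLF
open Literature.Computability.MetaComplexity Literature.Computability.MetaComplexity.Smolensky
open Summit.QuantumAdvantage.AdviceFreeQNC0
open Summit.QuantumAdvantage.QuantumAdvantage.Theorems.HolonomyDial (gCond)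
open Summit.QuantumAdvantage.QuantumAdvantage.Theorems.LocusDial
open Summit.QuantumAdvantage.QuantumAdvantage.Theorems.AnchorDial (dev outB win_iff card_odd_ge)
open Summit.QuantumAdvantage.QuantumAdvantage.Theorems.HolonomyDial (card_odd_le)
open Summit.QuantumAdvantage.QuantumAdvantage.Theorems.StabilizerDial (eventually_polylog StabFew stabFew_of_fewLocus)

/-! ## §H  FIXED DEVIATION PATTERNS OF ANY SIZE UP TO `√n/4`: the `t = 0` instance (blind strategies, sparse AND dense) -/

section FixedPattern
variable {N : ℕ}

open Summit.QuantumAdvantage.QuantumAdvantage.Theorems.StabilizerDial (pad winset_pad)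

/-- **fixed-pattern loss**: if the deviation set of `P` is ONE FIXED set `T` on every odd input, with `16·(|T|+6)² ≤ N` — i.e. ANY
pattern of up to `√N/4 − 6` positions, far beyond polylog (the DENSE blind regime included) — then at least a quarter of the odd class
loses: `#odd ≤ 4·#{odd losers}`.  (`table_loss` with NO hash, `t = 0`, the constant table `T`, `j = 8|T| + 44`.) -/
theorem fixedPattern_loss (T : Finset (Fin N)) (hT : 16 * (T.card + 6) ^ 2 ≤ N) (P : Fin N → CubeFn (ZMod 3) N)
    (hdev : ∀ x, OddZeros x → dev P x = T) :
    (univ.filter fun x : Fin N → Bool => OddZeros x).card ≤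
      4 * (univ.filter fun x : Fin N → Bool => OddZeros x ∧ ¬ Rel x (outB P x)).card := by
  have h36 : 6 ^ 2 ≤ (T.card + 6) ^ 2 := Nat.pow_le_pow_left (by omega) 2
  have hN : 3 ≤ N := by
    set q := (T.card + 6) ^ 2
    omega
  have hwN : (T.card + 1) * (2 * (8 * T.card + 44)) + 1 ≤ N :=
    le_trans (by nlinarith [Nat.zero_le T.card]) hT
  exact table_loss (t := 0) hN (fun s => s.elim0) (fun _ => T) T.card (8 * T.card + 44) (fun _ => le_rfl) hwN
    (by omega) (by omega) P (fun x hx => hdev x hx)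

/-- **`FixedPatternLoss3`** — packaged, for every `n`: blind strategies with ANY fixed deviation pattern of up to `√n/4 − 6`
positions (sparse or dense) win at most `(1 − 1/n)·2^{n−1}` of the odd class; the GAUGED form (some gauge makes the pattern fixed)
is included. -/
def FixedPatternLoss3 : Prop := ∀ n : ℕ, ∀ T : Finset (Fin n), 16 * (T.card + 6) ^ 2 ≤ n →
  ∀ P : Fin n → CubeFn (ZMod 3) n,
    (∃ s : Fin n → CubeFn (ZMod 3) n, ∀ x, OddZeros x → dev (pad P s) x = T) →
    ((univ.filter fun x : Fin n → Bool => OddZeros x ∧ Rel x (fun i => decide (P i x = 1))).card : ℝ) ≤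
      (1 - 1 / (n : ℝ) ^ 1) * (2 : ℝ) ^ (n - 1)

/-- **PROVED.** -/
theorem fixedPatternLoss3 : FixedPatternLoss3 := by
  intro n T hT P hs
  obtain ⟨s, hdev⟩ := hs
  have h36 : 6 ^ 2 ≤ (T.card + 6) ^ 2 := Nat.pow_le_pow_left (by omega) 2
  have h4 : 4 ≤ n := by
    set q := (T.card + 6) ^ 2
    omega
  have hq := fixedPattern_loss T hT (pad P s) hdev
  have h := real_loss_of_frac (M := 4) (by norm_num) h4 (by omega) (pad P s) hq
  rwa [winset_pad] at h

end FixedPattern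

/-- info: 'Summit.QuantumAdvantage.QuantumAdvantage.Theorems.SparsityDial.fixedPatternLoss3' depends on axioms: [propext,
 Classical.choice,
 Quot.sound] -/
#guard_msgs in #print axioms fixedPatternLoss3



end Summit.QuantumAdvantage.QuantumAdvantage.Theorems.SparsityDial
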